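import Summits.CriticalPhenomena.PercolationContinuityZ3.Theses.PercNearOneGluing
import Summits.CriticalPhenomena.PercolationContinuityZ3.Theorems.PercNearOneGluingAdditiveGluingKnLemma3Mixed
import Literature.Probability.Percolation.KozmaNitzanPreFKG
import HarnessLib

/-! # Crux `PercNearOneGluing.AdditiveGluing` (stmt-CriticalPhenomena-4576), line `starglue` —
stub `stub_twoSidedExchange_sg`: the two-sided Kozma–Nitzan exchange lemma

For the bond percolation measure `μ = prodBernoulli w` of a finite weighted graph on `Fin n`,
vertices `a, c, b` and a finite vertex set `N`: if `μ(a ↔ b) ≤ μ(c ↔ b)` then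
`μ(a ↔ b, a ↮ N, c ↔ N) ≤ μ(c ↔ b, a ↮ N, c ↔ N)`, where `{a ↮ N} = {∀ x ∈ N, ¬ a ↔ x}` is
decreasing in the open cluster of `a` and `{c ↔ N} = ⋃_{x ∈ N} {c ↔ x}` is increasing in the open
cluster of `c` (Kozma–Nitzan, arXiv:2401.12397, Lemma 3 (pp. 6–7), parts (i) and (ii) at once).

## Proof

The conditioning event `Q = {c ↔ N} ∩ {a ↮ N}` is a mixed-monotone function of the pair of open
edge clusters `(C_c, C_a)` — increasing in `C_c`, decreasing in `C_a` — so this is the landed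
mixed form of Lemma 3, `knLemma3Mixed_setObserver` (file `…AdditiveGluingKnLemma3Mixed.lean`,
proved from van den Berg–Häggström–Kahn 2006, Thm. 1.5, twice on `D = {c ↮ a}`), at slack `d = 0`,
after reordering the intersection.
-/

namespace Summit.CriticalPhenomena.PercolationContinuityZ3.Theorems

open MeasureTheory Set Literature.Probability.LatticeModels Literature.Probability.Percolation
open scoped Classical BigOperators

/-- Reordering of the two-sided exchange event: `{d ↔ b} ∩ {a ↮ N} ∩ ⋃_{x∈N} {c ↔ x}` is
`{d ↔ b} ∩ {(∃ y ∈ N, c ↔ y) ∧ ∀ y ∈ N, ¬ a ↔ y}`. [folklore] -/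
theorem twoSidedExchange_event_eq {n : ℕ} (d b a c : Fin n) (N : Finset (Fin n)) :
    (openConn d b : Set (BondConfig (Fin n))) ∩
        {ω | ∀ x ∈ N, ¬ (openGraph ω).Reachable a x} ∩ (⋃ x ∈ N, openConn c x) =
      openConn d b ∩ {ω : BondConfig (Fin n) | (∃ y ∈ N, (openGraph ω).Reachable c y) ∧
        ∀ y ∈ N, ¬ (openGraph ω).Reachable a y} := by
  ext ω
  simp only [mem_inter_iff, mem_setOf_eq, mem_iUnion, openConn, exists_prop]
  tauto

/-- **Two-sided Kozma–Nitzan exchange lemma** (registered stub `stub_twoSidedExchange_sg` of line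
`starglue`).  If `μ(a ↔ b) ≤ μ(c ↔ b)` for `μ = prodBernoulli w`, then
`μ(a ↔ b, a ↮ N, c ↔ N) ≤ μ(c ↔ b, a ↮ N, c ↔ N)`: the event `{a ↮ N}` is decreasing in the cluster
of `a` (Lemma 3(ii)) and `{c ↔ N}` is increasing in the cluster of `c` (Lemma 3(i)); jointly they
form a mixed-monotone event of `(C_c, C_a)`, handled by `knLemma3Mixed_setObserver` (BHK 2006
Thm. 1.5 twice given `{a ↮ c}`).
[cite: KozmaNitzan2024, Lemma 3 (pp. 6–7)] [cite: VandenbergHaggstromKahn2005, Thm. 1.5 (p. 7)] -/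
theorem stub_twoSidedExchange_sg : ∀ (n : ℕ) (w : Sym2 (Fin n) → unitInterval) (a c b : Fin n) (N : Finset (Fin n)), (Literature.Probability.LatticeModels.prodBernoulli w).real (Literature.Probability.Percolation.openConn a b) ≤ (Literature.Probability.LatticeModels.prodBernoulli w).real (Literature.Probability.Percolation.openConn c b) → (Literature.Probability.LatticeModels.prodBernoulli w).real (Literature.Probability.Percolation.openConn a b ∩ {ω | ∀ x ∈ N, ¬ (Literature.Probability.Percolation.openGraph ω).Reachable a x} ∩ (⋃ x ∈ N, Literature.Probability.Percolation.openConn c x)) ≤ (Literature.Probability.LatticeModels.prodBernoulli w).real (Literature.Probability.Percolation.openConn c b ∩ {ω | ∀ x ∈ N, ¬ (Literature.Probability.Percolation.openGraph ω).Reachable a x} ∩ (⋃ x ∈ N, Literature.Probability.Percolation.openConn c x)) := by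
  intro n w a c b N h
  rw [twoSidedExchange_event_eq a b a c N, twoSidedExchange_event_eq c b a c N]
  have key := knLemma3Mixed_setObserver n w a c b N 0 le_rfl (by rw [add_zero]; exact h)
  rw [add_zero] at key
  exact key

end Summit.CriticalPhenomena.PercolationContinuityZ3.Theorems
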